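import Mathlib

/-!
# Continuous characters of compact groups are unitary
(kernel witness for the reduction of ℂˣ-valued characters to `Circle`-valued ones in the
Tier-5 [A]-ledger, items (A3)(b) / (A8b): «characters of … extend», with `ℂˣ` as target)

The [A]-ledger states its extension facts for characters with values in `ℂˣ` («ℂˣ is
divisible»); the kernel files `T5ContinuousCharacterExtension` and
`T5ProfiniteCharacterExtension` prove them for UNITARY characters (values in `Circle`).  The two
readings agree for compact groups because a continuous homomorphism from a compact group to `ℂˣ`
has unitary values: its image is bounded, and a bounded subgroup of `ℂˣ` lies on the unit circle
(if `‖φ g‖ > 1` then `‖φ (g ^ n)‖ = ‖φ g‖ ^ n → ∞`; if `‖φ g‖ < 1` apply this to `g⁻¹`).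

* `norm_eq_one_of_bddAbove` — a homomorphism `φ : G →* ℂˣ` with `‖φ g‖ ≤ M` for all `g` is
  unitary (no topology);
* `norm_eq_one_of_compact` — a continuous `φ : G →* ℂˣ` on a compact topological group is unitary;
* `toCircle` / `continuous_toCircle` — the unitary character as a continuous `G →* Circle`
  (`(toCircle φ h g : ℂ) = φ g`);
* `continuous_toUnits` — the converse coercion `Circle →* ℂˣ` is continuous;
* `norm_eq_one_of_isClosed` — the closed-subgroup form: a continuous `φ : H →* ℂˣ` on a CLOSED
  subgroup `H` of a compact group is unitary.

Mathlib-only; axioms standard.  Uses an L-value-free non-vanishing device: NO (README §8(d)).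
-/

namespace Summit.Ventures.HodgeRepro2.T5CompactCharacterUnitary

open Filter Topology

section Algebraic

variable {G : Type*} [Group G]

/-- A homomorphism `φ : G →* ℂˣ` with bounded values is unitary: `‖φ g‖ = 1` for every `g`. -/
theorem norm_eq_one_of_bddAbove (φ : G →* ℂˣ) {M : ℝ} (hM : ∀ g, ‖(φ g : ℂ)‖ ≤ M) (g : G) :
    ‖(φ g : ℂ)‖ = 1 := by
  -- first `‖φ g‖ ≤ 1` for all `g`: otherwise the powers are unbounded
  have key : ∀ g : G, ‖(φ g : ℂ)‖ ≤ 1 := by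
    intro g
    by_contra hlt
    rw [not_le] at hlt
    have ht : Tendsto (fun n : ℕ => ‖(φ g : ℂ)‖ ^ n) atTop atTop :=
      tendsto_pow_atTop_atTop_of_one_lt hlt
    obtain ⟨n, hn⟩ := (ht.eventually (eventually_gt_atTop M)).exists
    have hMn := hM (g ^ n)
    rw [map_pow, Units.val_pow_eq_pow_val, norm_pow] at hMn
    linarith
  refine le_antisymm (key g) ?_
  have h1 := key g⁻¹
  rw [map_inv, Units.val_inv_eq_inv_val, norm_inv] at h1
  have hpos : 0 < ‖(φ g : ℂ)‖ := norm_pos_iff.mpr (φ g).ne_zero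
  rwa [inv_le_one₀ hpos] at h1

/-- A unitary homomorphism `φ : G →* ℂˣ` as a homomorphism into the circle. -/
noncomputable def toCircle (φ : G →* ℂˣ) (h : ∀ g, ‖(φ g : ℂ)‖ = 1) : G →* Circle where
  toFun g := ⟨(φ g : ℂ), mem_sphere_zero_iff_norm.mpr (h g)⟩
  map_one' := by
    ext
    simp
  map_mul' x y := by
    ext
    simp

/-- `toCircle φ h` has the same complex values as `φ`. -/
@[simp]
theorem toCircle_coe (φ : G →* ℂˣ) (h : ∀ g, ‖(φ g : ℂ)‖ = 1) (g : G) :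
    ((toCircle φ h g : Circle) : ℂ) = (φ g : ℂ) :=
  rfl

end Algebraic

section Topological

variable {G : Type*} [Group G] [TopologicalSpace G]

/-- A continuous homomorphism from a compact topological group to `ℂˣ` is unitary. -/
theorem norm_eq_one_of_compact [CompactSpace G] (φ : G →* ℂˣ) (hφ : Continuous φ) (g : G) :
    ‖(φ g : ℂ)‖ = 1 := by
  obtain ⟨C, hC⟩ :=
    isCompact_univ.exists_bound_of_continuousOn (Units.continuous_val.comp hφ).continuousOn
  exact norm_eq_one_of_bddAbove φ (fun g => hC g (Set.mem_univ g)) g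

/-- A continuous homomorphism to `ℂˣ` on a CLOSED subgroup of a compact topological group is
unitary (a closed subgroup of a compact space is compact). -/
theorem norm_eq_one_of_isClosed [CompactSpace G] (H : Subgroup G) (hH : IsClosed (H : Set G))
    (φ : H →* ℂˣ) (hφ : Continuous φ) (h : H) : ‖(φ h : ℂ)‖ = 1 := by
  haveI : CompactSpace H := isCompact_iff_compactSpace.mp hH.isCompact
  exact norm_eq_one_of_compact φ hφ h

/-- `toCircle` is continuous when `φ` is. -/
theorem continuous_toCircle (φ : G →* ℂˣ) (h : ∀ g, ‖(φ g : ℂ)‖ = 1) (hφ : Continuous φ) :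
    Continuous (toCircle φ h) :=
  (Units.continuous_val.comp hφ).subtype_mk _

/-- The coercion `Circle →* ℂˣ` (`Circle.toUnits`) is continuous. -/
theorem continuous_toUnits : Continuous (Circle.toUnits : Circle → ℂˣ) := by
  refine Units.continuous_iff.mpr ⟨continuous_subtype_val, ?_⟩
  have : (fun z : Circle => ((Circle.toUnits z : ℂˣ)⁻¹ : ℂˣ).val) =
      fun z : Circle => ((z : ℂ))⁻¹ := by
    funext z
    simp
  rw [this]
  exact continuous_subtype_val.inv₀ fun z => Circle.coe_ne_zero z

/-- Composite: a continuous `χ : G →* Circle` gives a continuous `G →* ℂˣ` with the same values. -/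
theorem continuous_toUnits_comp (χ : G →* Circle) (hχ : Continuous χ) :
    Continuous (Circle.toUnits.comp χ) :=
  continuous_toUnits.comp hχ

end Topological

end Summit.Ventures.HodgeRepro2.T5CompactCharacterUnitary
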